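import Literature.AnabelianGeometry.EtaleTheta.Discharge.Sec3TemperedFrobenioidDataAutPhiTrivialOfRigidOverBase
import HarnessLib

/-!
# [EtTh] Def. 3.6 tempered Frobenioids: at a SLIM base the [IUTchI] Cor. 5.3 (iv) injectivity conclusion `RigidOverBase` forces
# EVERY automorphism of the data `(Φ, B, Div_B)` over `id_D` to be TRIVIAL — the unit half `b = id`; hence `RigidOverBase ⟹
# DivisorDataRigid` and, modulo the [FrdI] six + `SelfEquivInducesDataAut`, the IFF (proof-only)

S. Mochizuki, *The geometry of Frobenioids I*, Kyushu J. Math. **62** (2008): §0 p. 14 («slim»), Thm. 5.2 (i) p. 100 (a morphism of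
the model category IS `(deg_Fr, Base, Div, u)`; `u_{ψ∘φ} = Base(φ)^* u_ψ · u_φ^{deg_Fr ψ}`), Cor. 5.4 p. 104 (functoriality in the data)
[cite: MochizukiFrdI2008, Thm. 5.2 (i) p.100] [cite: MochizukiFrdI2008, Cor. 5.4 p.104] [cite: MochizukiFrdI2008, §0 p.14];
S. Mochizuki, *The étale theta function …*, Def. 3.6 p. 77 [cite: MochizukiEtTh2009, Def 3.6 p.77].  Consumer locus: [IUTchI]
Cor. 5.3 (iv) p. 144 («`Aut(ℱ̲_v̲) → Aut(𝒟_v̲)` is bijective»; p. 145 l. 1–2 «it suffices to verify that `α` induces the identity on the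
rational function and divisor monoids») ([IUTchI] Cor 5.3 (iv) p.144) [claim: Mochizuki2012, status: disputed] (nothing of the series
asserted; no side taken on [IUTchIII] Cor. 3.12).

PROOF-ONLY (cell abc-iut; row «C53IV-DDR-INNER (⇒)» FILE 1, KEY DDRINNER re-keyed abc-iut-L5-t1 → abc-iut-L5-t11 by abc-iut-L5-lead
RULINGS #203 (2) / #208, basename per RULINGS #209 (2); L2 directory on abc-iut-L2-lead R1530 guest rails (R1578: no objection), L5
custody; 0 def · 0 instance · 0 notation · no Prop fact).
CONTEXT.  ★ `TemperedFrobenioid.dataAut_a_eq_self_of_rigidOverBase` (abc-iut-L5-t1, (β)) is the DIVISOR half: at a slim base with `Φ`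
divisorial, `RigidOverBase C.baseFunctorOfCategory` forces `τ.a = id` for every data automorphism `τ = (a, b)`.  The row's planning memo
(abc-iut-L5-t1 g13, 'HOME/staging/L5/L5-t1/g13/DDR-NECESSARY-AND-SUFFICIENT-NEXT.md' sha16 8961f501be85682a, the plan's author) expected
the UNIT half only up to a «coboundary» `b_A(u) · c_Y = c_X · u` (`c_X := u_{ι_X}` for `ι : Ψ_τ ≅ 𝟭`).  THIS FILE shows the
coboundary is TRIVIAL — `c` is constant on every fibre of `Base` — so ONE naturality square gives `b = id` outright:
* §1 **`ModelFrobenioid.DataHomOver.beta_apply_eq_self_of_rigidOverBase`** — ANY model data over a SLIM `D` (no divisoriality), any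
  morphism `h = (η, β)` of the data over `𝟭_D` with bijective components: `RigidOverBase (baseFunctor Φ B Div_B) ⟹ β_A(u) = u`.  PROOF:
  `ι : Ψ_h ≅ 𝟭` ([FrdI] Cor. 5.4 = `DataHomOver.functor_isEquivalence`), `ι_X = (1, g_X, ·, c_X)` with `c_X` INVERTIBLE; (a) `g_{(A,0)}
  = id` — natural along the lifts `(1, f, 0, 1)`, trivial by slimness ((β)'s step re-run); (b) unit entry of the square at `(1, id, Z, 1) :
  (A, q) → (A, q+[Z])`: `c_{q+[Z]} · β(1) = c_q`, and every class is `[Z₁] − [Z₂]`, so `c` is constant on the fibre; (c) unit entry of the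
  square at `(1, id_A, 0, u) : (A, 0) → (A, −Div_B u)`: `c · β_A(u) = g_{(A,0)}^* u · c = u · c`.
* §2 **`TemperedFrobenioid.dataAut_b_eq_self_of_rigidOverBase`** / `…_eq_refl_…` (NO [FrdI] hypothesis used for this half);
  **`divisorDataRigid_of_rigidOverBase`** (with (β), under the Thm 5.2 `Hypotheses`: only «`Φ` divisorial» used) — the DISPLAYED [EtTh]
  binder of the (iv) telescope is NECESSARY; **`rigidOverBase_iff_divisorDataRigid`** — with abc-iut-L2-t12's ★ `rigidOverBase_of_divisorDataRigid`.
NV / consistency (docstring only): (i) at `temperedFrobenioidSmall` the cusp swap (★ `not_divisorDataRigid_temperedFrobenioidSmall`,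
`a ≠ id`) violates `DivisorDataRigid` ⇒ IF that base were slim `RigidOverBase` fails — ★ p544475, untouched; (ii) the unit twists `Ψ_w`,
`u_φ ↦ u_φ · w^{deg_Fr φ − 1}`, of ★ `ModelFrobenioid.exists_unitTwist_selfEquivalence` (L5-R22, ★ `Cor53ivTelescopeBinderVacuity`) ARE
`≅ 𝟭` but are NOT `Ψ_τ` for a data automorphism with `b ≠ id` (their unit action depends on `deg_Fr` and is the identity on linear
arrows) — consistent with `b = id`; the memo's premise «`RigidOverBase` does not force `τ.b = id`» conflated the two and is corrected here.
HONEST LABELS: OUR theorems about OUR model carriers, the NECESSARY direction at SLIM bases (no claim that any carrier of record is slim);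
refutable-as-typed at a design carrier ≠ refuted in print (print's cusps are LABELLED, [EtTh] Prop. 1.3); no token moved; typed ≠
inhabited ≠ proved; nothing here asserts abc proved or refuted.
-/

noncomputable section

/-! ### §1. Generic form: the unit half of a morphism of model data over `𝟭_D`, at a slim base -/

namespace Literature.AnabelianGeometry.EtaleTheta

open CategoryTheory Opposite Literature.AlgebraicGeometry.Frobenioids Literature.IUT.HodgeTheaters

section Generic

universe w' v' u'

variable {D : Type u'} [Category.{v'} D] {Φ B : Dᵒᵖ ⥤ CommMonCat.{w'}} {DivB : B ⟶ monoidGp Φ}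

/-- **GENERIC FORM ([FrdI] Thm 5.2 model category of ANY data `(D, Φ, B, Div_B)` over a SLIM `D`; no divisoriality).**  For a morphism
`h = (η, β)` of the model data over `𝟭_D` with bijective components, `CatIsomorphism.RigidOverBase (baseFunctor Φ B Div_B)` forces
`β_A(u) = u` for all `A`, `u ∈ B(A)`: with `ι : Ψ_h ≅ 𝟭` ([FrdI] Cor 5.4: `DataHomOver.functor_isEquivalence`, `functor_comp_baseFunctor`)
and `c_X := u_{ι_X}` (invertible: `deg_Fr ι_X⁻¹ = 1`), `Base(ι_{(A,0)}) = id` by slimness (natural along the lifts `(1, f, 0, 1)`), `c` is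
constant on the fibre over `A` (unit entry of the square at `(1, id, Z, 1)`; every class is `[Z₁] − [Z₂]`), and the unit entry of the
square at `(1, id_A, 0, u) : (A, 0) → (A, −Div_B u)` reads `c · β_A(u) = u · c`.  (Absolute-name dot-notation extension of abc-iut-L1's
`ModelFrobenioid.DataHomOver`, lean/CONVENTIONS.md §2.) [cite: MochizukiFrdI2008, Cor. 5.4 p.104] [cite: MochizukiFrdI2008, §0 p.14] -/
theorem _root_.Literature.AlgebraicGeometry.Frobenioids.ModelFrobenioid.DataHomOver.beta_apply_eq_self_of_rigidOverBase
    (h : ModelFrobenioid.DataHomOver (𝟭 D) DivB DivB) (hsl : IsSlim D)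
    (hη : ∀ X : D, Function.Bijective (h.η.app (op X)).hom) (hβ : ∀ X : D, Function.Bijective (h.β.app (op X)).hom)
    (hR : CatIsomorphism.RigidOverBase (ModelFrobenioid.baseFunctor Φ B DivB)) (A : Dᵒᵖ) (u : B.obj A) :
    (h.β.app A).hom u = u := by
  haveI := h.functor_isEquivalence hη hβ
  -- the induced self-equivalence `Ψ_h` lies over `id_D`; rigidity gives `ι : Ψ_h ≅ 𝟭`
  obtain ⟨ι⟩ := hR h.functor.asEquivalence ⟨eqToIso h.functor_comp_baseFunctor⟩
  -- (a) the base components of `ι` at the objects `(E, 0)` are trivial (slimness; (β)'s step)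
  let X₀ : D → ModelFrobenioid Φ B DivB := fun E => ⟨E, 1⟩
  let gi : ∀ E : D, E ≅ E := fun E => (ModelFrobenioid.baseFunctor Φ B DivB).mapIso (ι.app (X₀ E))
  have hg : ∀ ⦃E E' : D⦄ (f : E ⟶ E'), f ≫ (gi E').hom = (gi E).hom ≫ f := by
    intro E E' f
    let F : X₀ E ⟶ X₀ E' :=
      { degFr := 1, base := f, div := 1, unit := 1
        rel := by
          change (1 : Algebra.GrothendieckGroup (Φ.obj (op E))) ^ ((1 : ℕ+) : ℕ) * Algebra.GrothendieckGroup.of 1 =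
            pullGp Φ f 1 * Literature.AlgebraicGeometry.Frobenioids.divB Φ B DivB (op E) 1
          rw [one_pow, map_one, map_one, map_one] }
    have n := congrArg ModelFrobenioid.baseMap (ι.hom.naturality F)
    rw [ModelFrobenioid.baseMap_comp, ModelFrobenioid.baseMap_comp] at n
    exact n
  have hg1 : ∀ E : D, (gi E).hom = 𝟙 E := by
    intro E
    let α : Over.forget E ≅ Over.forget E := NatIso.ofComponents (fun U => gi U.left) (fun {U U'} k => hg k.left)
    have hα := hsl.isRigid_forget E α
    have h1 := congrArg (fun γ : Over.forget E ≅ Over.forget E => γ.hom.app (Over.mk (𝟙 E))) hα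
    simp only [α, NatIso.ofComponents_hom_app, Iso.refl_hom, NatTrans.id_app] at h1
    exact h1
  -- the objects over `A₀ := A` and the unit entries `c q` of `ι` at them
  let A₀ : D := unop A
  let O : Algebra.GrothendieckGroup (Φ.obj (op A₀)) → ModelFrobenioid Φ B DivB := fun q => ⟨A₀, q⟩
  let c : Algebra.GrothendieckGroup (Φ.obj (op A₀)) → B.obj (op A₀) := fun q => ModelFrobenioid.unit (ι.hom.app (O q))
  -- the component `β_A : B(A) → B(A)` as a plain monoid homomorphism
  let β₀ : B.obj (op A₀) →* B.obj (op A₀) := (h.β.app (op A₀)).hom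
  -- every `c q` is invertible (`ι_X ∘ ι_X⁻¹ = id`, `deg_Fr ι_X⁻¹ = 1`)
  have hcu : ∀ q, IsUnit (c q) := by
    intro q
    have hd : ModelFrobenioid.degFr (ι.inv.app (O q)) = 1 := (ModelFrobenioid.degFr_hom_eq_one (ι.app (O q))).2
    have e := congrArg ModelFrobenioid.unit (ι.hom_inv_id_app (O q))
    let v : B.obj (op A₀) := pull B (ModelFrobenioid.baseMap (ι.hom.app (O q))) (ModelFrobenioid.unit (ι.inv.app (O q)))
    have e' : v * c q ^ (ModelFrobenioid.degFr (ι.inv.app (O q)) : ℕ) = 1 := e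
    rw [hd, PNat.one_coe, pow_one] at e'
    exact IsUnit.of_mul_eq_one_right _ e'
  -- (b) `c` is constant along the linear arrows `(1, id, Z, 1) : (A, q) → (A, q + [Z])`
  have hcZ : ∀ (q : Algebra.GrothendieckGroup (Φ.obj (op A₀))) (Z : Φ.obj (op A₀)),
      c (q * Algebra.GrothendieckGroup.of Z) = c q := by
    intro q Z
    let L : O q ⟶ O (q * Algebra.GrothendieckGroup.of Z) := ModelFrobenioid.mkHom _ _ 1 (𝟙 A₀) Z 1 (by
      change q ^ ((1 : ℕ+) : ℕ) * Algebra.GrothendieckGroup.of Z =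
        pullGp Φ (𝟙 A₀) (q * Algebra.GrothendieckGroup.of Z) * Literature.AlgebraicGeometry.Frobenioids.divB Φ B DivB (op A₀) 1
      rw [PNat.one_coe, pow_one, pullGp_id, map_one, mul_one])
    have hd : ModelFrobenioid.degFr (ι.hom.app (O (q * Algebra.GrothendieckGroup.of Z))) = 1 :=
      (ModelFrobenioid.degFr_hom_eq_one (ι.app (O (q * Algebra.GrothendieckGroup.of Z)))).1
    have n := congrArg ModelFrobenioid.unit (ι.hom.naturality L)
    -- the pull-back along `Base(ι_{(A,q)})`, as a plain monoid homomorphism of `B(A)`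
    let P : B.obj (op A₀) →* B.obj (op A₀) := pull B (ModelFrobenioid.baseMap (ι.hom.app (O q)))
    -- `n : id^* c_{q+[Z]} · β(1)^{deg ι} = Base(ι_{(A,q)})^* 1 · c_q ^ 1`
    have n' : pull B (𝟙 A₀) (c (q * Algebra.GrothendieckGroup.of Z)) *
          β₀ 1 ^ (ModelFrobenioid.degFr (ι.hom.app (O (q * Algebra.GrothendieckGroup.of Z))) : ℕ) =
        P 1 * c q ^ ((1 : ℕ+) : ℕ) := n
    rw [hd] at n'
    simp only [map_one, mul_one, one_mul, pull_id, PNat.one_coe, pow_one] at n'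
    exact n'
  -- every class is a difference `[Z₁] − [Z₂]` ([FrdI] §0: groupification)
  have hdec : ∀ q : Algebra.GrothendieckGroup (Φ.obj (op A₀)), ∃ Z₁ Z₂ : Φ.obj (op A₀),
      q = Algebra.GrothendieckGroup.of Z₁ / Algebra.GrothendieckGroup.of Z₂ := by
    intro q
    induction q using Localization.induction_on with
    | H p =>
      refine ⟨p.1, p.2, eq_div_iff_mul_eq'.mpr ?_⟩
      show Localization.mk p.1 p.2 * Localization.mk (p.2 : Φ.obj (op A₀)) 1 = Localization.mk p.1 1
      rw [Localization.mk_mul, Localization.mk_eq_mk_iff, Localization.r_iff_exists]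
      exact ⟨1, by simp [mul_comm]⟩
  -- hence `c` is constant on the fibre over `A`
  have hc1 : ∀ q, c q = c 1 := by
    intro q
    obtain ⟨Z₁, Z₂, hq⟩ := hdec q
    have h₁ : c q = c (Algebra.GrothendieckGroup.of Z₁) := by
      rw [← hcZ q Z₂, hq, div_mul_cancel]
    rw [h₁, ← hcZ 1 Z₁, one_mul]
  -- (c) the unit entry of the square at `(1, id_A, 0, u) : (A, 0) → (A, −Div_B u)`
  let Y : ModelFrobenioid Φ B DivB := O (Literature.AlgebraicGeometry.Frobenioids.divB Φ B DivB (op A₀) u)⁻¹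
  let G : X₀ A₀ ⟶ Y := ModelFrobenioid.mkHom _ _ 1 (𝟙 A₀) 1 u (by
    change (1 : Algebra.GrothendieckGroup (Φ.obj (op A₀))) ^ ((1 : ℕ+) : ℕ) * Algebra.GrothendieckGroup.of 1 =
      pullGp Φ (𝟙 A₀) (Literature.AlgebraicGeometry.Frobenioids.divB Φ B DivB (op A₀) u)⁻¹ *
        Literature.AlgebraicGeometry.Frobenioids.divB Φ B DivB (op A₀) u
    rw [one_pow, map_one, one_mul, pullGp_id, inv_mul_cancel])
  have hd : ModelFrobenioid.degFr (ι.hom.app Y) = 1 := (ModelFrobenioid.degFr_hom_eq_one (ι.app Y)).1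
  have n := congrArg ModelFrobenioid.unit (ι.hom.naturality G)
  -- `n : id^* c_Y · β(u)^{deg ι_Y} = Base(ι_{(A,0)})^* u · c_{(A,0)} ^ 1`
  have n' : pull B (𝟙 A₀) (c (Literature.AlgebraicGeometry.Frobenioids.divB Φ B DivB (op A₀) u)⁻¹) *
        β₀ u ^ (ModelFrobenioid.degFr (ι.hom.app Y) : ℕ) =
      pull B (gi A₀).hom u * c 1 ^ ((1 : ℕ+) : ℕ) := n
  rw [hd, PNat.one_coe, pow_one, pow_one, pull_id, hg1, pull_id,
    hc1 (Literature.AlgebraicGeometry.Frobenioids.divB Φ B DivB (op A₀) u)⁻¹, mul_comm u] at n'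
  exact (hcu 1).mul_left_cancel n'

end Generic

end Literature.AnabelianGeometry.EtaleTheta

/-! ### §2. At the [EtTh] Def 3.6 tempered Frobenioid: every data automorphism over `id_D` is trivial -/

namespace Literature.AnabelianGeometry.EtaleTheta

open CategoryTheory Opposite Literature.AlgebraicGeometry.Frobenioids Literature.IUT.HodgeTheaters

namespace TemperedFrobenioid

universe u₀ v₀ u v w

variable {D₀ : Type u₀} [Category.{v₀} D₀] {V : FrdIMonoidStub.{w}}
  {T : RealifiedDivisorMonoids (D₀ := D₀) V} {D : Type u} [Category.{v} D]
  {VD : FrdICatStub.{u, v, w} D} (C : TemperedFrobenioid T D VD)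

/-- **The unit half: `RigidOverBase` at a slim base forces `b = id`.**  Let `C` be an [EtTh] Def 3.6 tempered Frobenioid whose base `D`
is slim ([FrdI] §0).  If every self-equivalence of `C.category` over the identity of `D` is isomorphic to the identity
(`CatIsomorphism.RigidOverBase C.baseFunctorOfCategory`, the [IUTchI] Cor 5.3 (iv) injectivity conclusion of the tree's telescope), then
every automorphism `τ = (a, b)` of the data `(Φ, B, Div_B)` over `id_D` (abc-iut-L2-t12's `DataAut`) has `b = id` — §1 at the morphism of
data over `𝟭_D` defined by `τ`.  No [FrdI] standing hypothesis is used for this half.  OURS; the NECESSARY direction only; no claim that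
any carrier of record is slim. [cite: MochizukiFrdI2008, Cor. 5.4 p.104] [cite: MochizukiFrdI2008, §0 p.14]
[claim: Mochizuki2012, status: disputed] -/
theorem dataAut_b_eq_self_of_rigidOverBase (hsl : IsSlim D)
    (hR : CatIsomorphism.RigidOverBase C.baseFunctorOfCategory) (τ : C.DataAut)
    (A : Dᵒᵖ) (u : C.ratFnFunctor.obj A) : τ.b A u = u := by
  -- `τ` as a morphism of model data over `𝟭_D`
  let hd : ModelFrobenioid.DataHomOver (𝟭 D) C.divBNatTrans C.divBNatTrans :=
    { η := { app := fun A => CommMonCat.ofHom (τ.a A).toMonoidHom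
             naturality := fun A A' f => by
               apply CommMonCat.hom_ext
               ext y
               exact τ.a_natural f.unop y }
      β := { app := fun A => CommMonCat.ofHom (τ.b A).toMonoidHom
             naturality := fun A A' f => by
               apply CommMonCat.hom_ext
               ext u
               exact τ.b_natural f.unop u }
      comm := fun A u => (τ.divB_b A u).symm }
  exact hd.beta_apply_eq_self_of_rigidOverBase hsl (fun X => (τ.a (op X)).bijective) (fun X => (τ.b (op X)).bijective) hR A u

/-- **Reformulation**: at a slim base, `RigidOverBase` implies `τ.b A = id` (as a `MulEquiv`) for every data automorphism `τ` — the unit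
half of abc-iut-L2-t12's displayed binder `DivisorDataRigid C`. [cite: MochizukiFrdI2008, Cor. 5.4 p.104] [claim: Mochizuki2012, status: disputed] -/
theorem dataAut_b_eq_refl_of_rigidOverBase (hsl : IsSlim D)
    (hR : CatIsomorphism.RigidOverBase C.baseFunctorOfCategory) (τ : C.DataAut) (A : Dᵒᵖ) :
    τ.b A = MulEquiv.refl _ :=
  MulEquiv.ext fun u => C.dataAut_b_eq_self_of_rigidOverBase hsl hR τ A u

/-- **`RigidOverBase ⟹ DivisorDataRigid` at a slim base.**  Under the [FrdI] Thm 5.2 `Hypotheses` (displayed; only «`Φ` objectwise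
divisorial» is used, for the divisor half ★ `dataAut_a_eq_self_of_rigidOverBase`) at a slim base, the [IUTchI] Cor 5.3 (iv) injectivity
conclusion `RigidOverBase C.baseFunctorOfCategory` implies abc-iut-L2-t12's DISPLAYED rigidity binder `DivisorDataRigid C` («every
automorphism of the Def 3.6 data over `id_D` is trivial») — that binder is NECESSARY for the conclusion of the tree's (iv) telescope, not
merely sufficient.  OURS; no claim that any carrier of record is slim. [cite: MochizukiFrdI2008, Cor. 5.4 p.104] [cite: MochizukiFrdI2008, §0 p.14]
[claim: Mochizuki2012, status: disputed] -/
theorem divisorDataRigid_of_rigidOverBase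
    (h : ModelFrobenioid.Hypotheses C.divisorMonoid C.ratFnFunctor) (hsl : IsSlim D)
    (hR : CatIsomorphism.RigidOverBase C.baseFunctorOfCategory) : C.DivisorDataRigid :=
  fun τ => ⟨fun A x => C.dataAut_a_eq_self_of_rigidOverBase h hsl hR τ A x,
    fun A u => C.dataAut_b_eq_self_of_rigidOverBase hsl hR τ A u⟩

/-- **THE IFF (OURS, modulo the [FrdI] six and `SelfEquivInducesDataAut`).**  At an [EtTh] Def 3.6 tempered Frobenioid under the
[FrdI] Thm 5.2 `Hypotheses` whose base is slim, of FSMFF-type, with `Φ` non-dilating and not the zero monoid, and granting abc-iut-L2-t12's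
category-theoreticity shape `SelfEquivInducesDataAut C` (every self-equivalence over `id_D` arises from a data automorphism), the [IUTchI]
Cor 5.3 (iv) injectivity conclusion holds IFF the data `(Φ, B, Div_B)` has no non-trivial automorphism over `id_D`:
`RigidOverBase C.baseFunctorOfCategory ↔ DivisorDataRigid C` (⟸ = ★ `rigidOverBase_of_divisorDataRigid`, ⟹ = the preceding theorem, which
needs only slimness and divisoriality).  The necessary-and-sufficient form of the (iv) rigidity input at OUR carriers; nothing about print's
labelled cusps ([EtTh] Prop. 1.3). [cite: MochizukiFrdI2008, Cor. 5.4 p.104] [cite: MochizukiEtTh2009, Def 3.6 p.77]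
[claim: Mochizuki2012, status: disputed] -/
theorem rigidOverBase_iff_divisorDataRigid
    (h : ModelFrobenioid.Hypotheses C.divisorMonoid C.ratFnFunctor) (hsl : IsSlim D) (hfs : IsOfFSMFFType D)
    (hnd : IsNonDilatingOn C.divisorMonoid) (hz : ¬ ModelFrobenioid.IsZeroMonoid C.divisorMonoid)
    (hind : C.SelfEquivInducesDataAut) :
    CatIsomorphism.RigidOverBase C.baseFunctorOfCategory ↔ C.DivisorDataRigid :=
  ⟨fun hR => C.divisorDataRigid_of_rigidOverBase h hsl hR,
    fun hrig => C.rigidOverBase_of_divisorDataRigid h hsl hfs hnd hz hind hrig⟩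

end TemperedFrobenioid

end Literature.AnabelianGeometry.EtaleTheta

end
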